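import Literature.MathematicalPhysics.QuantumFieldTheory.Balaban1983to89.B13OpsYPencilLetters

/-!
# `Balaban1983to89.B13OpsYPencilHolonomy` — T. Bałaban, *Propagators for lattice gauge theories in a background field*, Commun. Math. Phys. **99**
# (1985) 389–434 [Balaban1985BackgroundPropagators], (3.1) p. 390 (`U(∂p)`), (3.7) p. 391 (`Re U(∂p)`, `Im U(∂p)`, the first curvature term), (3.4) p. 391,
# (3.9)–(3.10) p. 392 (`⟨A, ΔA⟩ = ⟨A, D*DA⟩ + ⟨A, Δ′A⟩`), p. 396 («U′ = exp iηA′»), Thm 3.4 and (3.50) p. 400 («Δ_{U′U} … an analytic function of A(b)»),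
# (3.108) p. 416; [Balaban1988RG2Cluster] (2.5) p. 12, p. 15: THE PLAQUETTE HOLONOMY `U(∂p)`, `Re U(∂p)`, `Im U(∂p)`, THE JORDAN INSERTION AND THE FIRST
# HESSIAN TERM `D*_U ∘ 𝒦_U ∘ D^η_U` OF NODE 00's `hessY` (`Node00/OpsYDeltaA`: `holY`, `reHolY`, `imHolY`, `jordanY`, `coCurlY ∘ₗ jordanY ∘ₗ curlY`) ALONG
# pv27's GROUP PENCIL `A′ ↦ prodCfg U₀ η A′`: holomorphy in `A′` and explicit bounds on every chart ball, for every input field and output bond.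

statement-level complex analysis ([folklore]: sums, products, scalar multiples of holomorphic bounded Banach-algebra-valued maps) AT NODE 00's `rfl`-level
definitions, over `B13OpsYPencilLetters` (the pencil's letters and the `gradT ∕ curlT` facts) and `B13TransportedLiftLetters` (`trLiftY_apply`, `R_def`);
kernel-checked; THEOREMS ONLY (no `def`, no `structure`, no instance, no notation); NOTHING of NODE 00's ∕ pv27's is modified — consumed BY NAME; nothing
here is a claim about the Yang–Mills mass gap; no node is discharged; count-neutral.

WHY THIS FILE (cell `pub-ymgap`, HUMAN RULING D-0062 ∕ D-0149, Track A node N10 = [B13]; seat `pub-ymgap-dag-n10-c` g14, INTENT-3; census v15 item 1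
«the complexified formulas of the LOCAL operators (Δ_U, …) on the chart at the record's members»).  `B13OpsYPencilLetters` (INTENT-2) delivered the four
DIFFERENTIAL letters of NODE 00 along the pencil; NODE 00's Hessian of (3.10) is `hessY U = coCurlY U ∘ₗ jordanY U ∘ₗ curlY U + curv2Y U` — a COMPOSITE
whose middle factor multiplies by the plaquette holonomy's real part and whose second summand conjugates by edge transports and commutes with `Im U(∂p)`.
Holomorphy of a composite along the pencil is NOT a statement about one `trLiftY` with a constant input: the input of the outer lift depends on `A′`.  THIS
FILE supplies (§1) the transported lift with an `A′`-DEPENDENT input (holomorphy + bound), (§2) the holonomy letters `holY ∕ reHolY ∕ imHolY` along the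
pencil (four-letter words: holomorphic, bounded by `Kη⁴`, `Kη := K₀e^{|η|R}`), (§3) the Jordan insertion of an `A′`-dependent field, and (§4) the FIRST HESSIAN
TERM `A′ ↦ (coCurlY ∘ jordanY ∘ curlY)(e^{iηA′}U₀) Λ b` — holomorphic on every chart ball for every input `Λ` and bond `b`, with an explicit bound in terms
of `Kη`, the kernels' row sums and `‖Λ‖`.  The commutator term `curv2Y` and `hessY` itself follow in the successor module (INTENT-4) by the same closure
rules over §1–§3.

WHAT THIS FILE PROVES (all `theorem`s; `𝔸` NODE 00's complete normed `ℂ`-algebra, `‖1‖ = 1` where bounds enter).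
* §1 (generic, any chart `E`, any carriers) `differentiableOn_trLiftY_apply` (transporter family with holomorphic values∕inverses + an input `Ψ(u)` holomorphic
  componentwise ⟹ `u ↦ (trLiftY M (T u) (Ψ u))(y)` holomorphic), `norm_trLiftY_apply_le` (`≤ (Σ_x |M(y,x)|)·(Kf·S·Kb)` when `‖Ψ(u)(x)‖ ≤ S`).
* §2 `val_holY` ∕ `val_inv_holY` (the holonomy and its inverse as four-letter products of configuration values), `differentiableOn_holY_prodCfg`,
  `differentiableOn_holY_inv_prodCfg`, `norm_holY_prodCfg_le`, `norm_holY_inv_prodCfg_le` (`≤ Kη⁴`), `differentiableOn_reHolY_prodCfg`, `norm_reHolY_prodCfg_le`,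
  `differentiableOn_imHolY_prodCfg`, `norm_imHolY_prodCfg_le` (`≤ Kη⁴`).
* §3 `jordanY_apply` (`(𝒦_U F)(p) = ½(F(p)·Re U(∂p) + Re U(∂p)·F(p))`, NODE 00's definition unfolded), `differentiableOn_jordanY_prodCfg` (for an `A′`-dependent
  holomorphic input), `norm_jordanY_prodCfg_le` (`≤ Kη⁴·S`).
* §4 ★ `differentiableOn_curlY_prodCfg_apply`, `norm_curlY_prodCfg_apply_le` (the curl of a FIXED field along the pencil), ★★
  `differentiableOn_dKd_prodCfg` — `A′ ↦ ((coCurlY ∘ₗ jordanY ∘ₗ curlY)(prodCfg U₀ η A′) Λ)(b)` is holomorphic on `‖A′‖ < R` for every `Λ`, `b` —, ★★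
  `norm_dKd_prodCfg_le` (`≤ c₂·Kη²·(Kη⁴·(c₁·Kη²·‖Λ‖))`, `0 ≤ c₁`, `c₁ ∕ c₂` row-sum bounds of `curlK ∕ cocurlK`), `dKd_eq_hessY_sub_curv2Y` (it IS `hessY − curv2Y` applied,
  NODE 00's definition).
HONEST FRAMING: NODE 00's DEFINITIONS read along pv27's DEFINITION of the pencil; inputs are the background's size `K₀ ≥ 1`, the chart radius, the flat kernels'
row sums; nothing of Bałaban's asserted (Thm 3.4's estimates (3.42)–(3.47) for these operators are N06's; here only the formula-level analyticity sentence is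
kernel-checked at NODE 00's objects); N06 ∕ N07 ∕ N10 NOT discharged; K1⁷ NOT closed; counts unmoved (typed 28∕28 · discharged 5∕27); no `sorry`, no new named
fact; standard axioms; one finite 𝕋⁴ programme at fixed ε, Bałaban AS PRINTED; the YM mass gap (Clay) is NOT proved by any of this — R4 closes the conditional
finite-𝕋⁴ rung `BalabanLadder.UV` only; nothing continuum ∕ ℝ⁴ ∕ OS.

References: T. Bałaban, CMP 99 (1985) 389–434 [Balaban1985BackgroundPropagators] (3.1) p.390, (3.4), (3.7) p.391, (3.9)–(3.10) p.392, p.396, Thm 3.4 and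
(3.50) p.400, (3.108) p.416; CMP 116 (1988) 1–22 [Balaban1988RG2Cluster] (2.5) p.12, p.15.
-/

noncomputable section

namespace Literature.MathematicalPhysics.QuantumFieldTheory.Balaban1983to89.B13OpsYPencilHolonomy

open Metric Set Complex
open NormedSpace (exp)
open Literature.MathematicalPhysics.QuantumFieldTheory.Balaban1983to89
open Literature.MathematicalPhysics.QuantumFieldTheory.Balaban1983to89.B9Eq39Adjoint (R R_def prodCfg)
open Literature.MathematicalPhysics.QuantumFieldTheory.Balaban1983to89.B6GlobalChartV1 (PV boxEquiv)
open Literature.MathematicalPhysics.QuantumFieldTheory.Balaban1983to89.B6KLevelCensusIndexV1 (KIdx)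
open Literature.MathematicalPhysics.QuantumFieldTheory.Balaban1983to89.Node00
  (SiteY FBondY PlaqY CfgY gradT curlT curlK cocurlK curlY coCurlY holY reHolY imHolY jordanY curv2Y hessY trLiftY trLiftY_apply)
open Literature.MathematicalPhysics.QuantumFieldTheory.Balaban1983to89.B13OpsYPencilLetters
  (differentiableOn_prodCfg_apply differentiableOn_prodCfg_inv_apply norm_prodCfg_apply_le norm_prodCfg_inv_apply_le
    differentiableOn_curlT_prodCfg differentiableOn_curlT_inv_prodCfg norm_curlT_prodCfg_le norm_curlT_inv_prodCfg_le)

variable {𝔸 : Type} [NormedRing 𝔸] [NormedAlgebra ℂ 𝔸] [CompleteSpace 𝔸]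

/-! ## §1. The transported lift with a u-dependent input (generic) -/

section Generic

variable {X Y : Type} [Fintype X] [Fintype Y]
variable {E : Type*} [NormedAddCommGroup E] [NormedSpace ℂ E]
variable (M : Matrix Y X ℝ) (T : E → Y → X → 𝔸ˣ) {Rc Kf Kb S : ℝ}

omit [CompleteSpace 𝔸] [Fintype Y] in
/-- **THE TRANSPORTED LIFT OF A u-DEPENDENT FIELD IS HOLOMORPHIC**: transporter values and inverses holomorphic on the ball, the input field
`u ↦ Ψ(u)(x)` holomorphic for every `x` ⟹ `u ↦ (M♯_{T(u)} Ψ(u))(y) = Σ_x M(y,x)·T(u)(y,x)·Ψ(u)(x)·T(u)(y,x)⁻¹` holomorphic for every `y` ([folklore]; the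
composite letters of (3.10) feed one lift's output into the next). [cite: Balaban1985BackgroundPropagators, (3.3) p.390, (3.10) p.392, Thm 3.4 and (3.50) p.400] -/
theorem differentiableOn_trLiftY_apply
    (hTf : ∀ y x, DifferentiableOn ℂ (fun u => (T u y x : 𝔸)) (ball (0 : E) Rc))
    (hTb : ∀ y x, DifferentiableOn ℂ (fun u => (((T u y x)⁻¹ : 𝔸ˣ) : 𝔸)) (ball (0 : E) Rc))
    {Ψ : E → X → 𝔸} (hΨ : ∀ x, DifferentiableOn ℂ (fun u => Ψ u x) (ball (0 : E) Rc)) (y : Y) :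
    DifferentiableOn ℂ (fun u => trLiftY M (T u) (Ψ u) y) (ball (0 : E) Rc) := by
  simp only [trLiftY_apply, R_def]
  refine DifferentiableOn.fun_sum fun x _ => ?_
  exact ((((hTf y x).mul (hΨ x)).mul (hTb y x)).const_smul (((M y x : ℝ) : ℂ)))

omit [CompleteSpace 𝔸] [Fintype Y] [NormedSpace ℂ E] in
/-- **… AND BOUNDED**: `‖T(u)(y,x)‖ ≤ Kf`, `‖T(u)(y,x)⁻¹‖ ≤ Kb`, `‖Ψ(u)(x)‖ ≤ S` on the ball ⟹ `‖(M♯_{T(u)} Ψ(u))(y)‖ ≤ (Σ_x |M(y,x)|)·(Kf·S·Kb)`.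
[cite: Balaban1985BackgroundPropagators, (3.3) p.390, Thm 3.4 p.400, (3.108) p.416] -/
theorem norm_trLiftY_apply_le
    (hKf : ∀ u ∈ ball (0 : E) Rc, ∀ y x, ‖(T u y x : 𝔸)‖ ≤ Kf)
    (hKb : ∀ u ∈ ball (0 : E) Rc, ∀ y x, ‖(((T u y x)⁻¹ : 𝔸ˣ) : 𝔸)‖ ≤ Kb)
    {Ψ : E → X → 𝔸} (hS : ∀ u ∈ ball (0 : E) Rc, ∀ x, ‖Ψ u x‖ ≤ S) {u : E} (hu : u ∈ ball (0 : E) Rc) (y : Y) :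
    ‖trLiftY M (T u) (Ψ u) y‖ ≤ (∑ x, |M y x|) * (Kf * S * Kb) := by
  rw [trLiftY_apply, Finset.sum_mul]
  refine (norm_sum_le _ _).trans (Finset.sum_le_sum fun x _ => ?_)
  rw [norm_smul, Complex.norm_real, Real.norm_eq_abs, R_def]
  refine mul_le_mul_of_nonneg_left ?_ (abs_nonneg _)
  have hf := hKf u hu y x
  have hb := hKb u hu y x
  have hs := hS u hu x
  have h0 : 0 ≤ Kf := (norm_nonneg _).trans hf
  have h1 : 0 ≤ S := (norm_nonneg _).trans hs
  calc ‖(T u y x : 𝔸) * Ψ u x * (((T u y x)⁻¹ : 𝔸ˣ) : 𝔸)‖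
      ≤ ‖(T u y x : 𝔸) * Ψ u x‖ * ‖(((T u y x)⁻¹ : 𝔸ˣ) : 𝔸)‖ := norm_mul_le _ _
    _ ≤ Kf * S * Kb :=
        mul_le_mul ((norm_mul_le _ _).trans (mul_le_mul hf hs (norm_nonneg _) h0)) hb (norm_nonneg _) (mul_nonneg h0 h1)

end Generic

/-! ## §2. The plaquette holonomy `U(∂p)`, `Re U(∂p)`, `Im U(∂p)` along the pencil -/

section Holonomy

variable {d ℓ : ℕ} {hd : 1 ≤ d + 1} {hL : Odd (ℓ + 1) ∧ 1 < ℓ + 1} {b₀ b₁ : ℝ}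
variable (i : KIdx d ℓ hd hL b₀ b₁) (U₀ : CfgY 𝔸 i) (η : ℝ) {Rc K₀ : ℝ}

omit [NormedAlgebra ℂ 𝔸] [CompleteSpace 𝔸] in
/-- **THE HOLONOMY AS A FOUR-LETTER WORD**: `U(∂p) = U_μ(x)·U_ν(x+e_μ)·U_μ(x+e_ν)⁻¹·U_ν(x)⁻¹` (NODE 00's `holY`, value in `𝔸`).
[cite: Balaban1985BackgroundPropagators, (3.1) p.390] -/
theorem val_holY [NormedAlgebra ℂ 𝔸] [CompleteSpace 𝔸] (U : CfgY 𝔸 i) (p : PlaqY i) :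
    (holY i U p : 𝔸) = (U p.μ p.src : 𝔸) * (U p.ν (p.src.shift p.μ) : 𝔸) * (((U p.μ (p.src.shift p.ν))⁻¹ : 𝔸ˣ) : 𝔸) *
      (((U p.ν p.src)⁻¹ : 𝔸ˣ) : 𝔸) := by
  simp only [holY, Units.val_mul]

omit [NormedAlgebra ℂ 𝔸] [CompleteSpace 𝔸] in
/-- … and its inverse `U(−∂p) = U_ν(x)·U_μ(x+e_ν)·U_ν(x+e_μ)⁻¹·U_μ(x)⁻¹` (the contour traversed backwards).
[cite: Balaban1985BackgroundPropagators, (3.1) p.390, (3.7) p.391 («U(−∂p) = U(∂p)⁻¹»)] -/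
theorem val_inv_holY [NormedAlgebra ℂ 𝔸] [CompleteSpace 𝔸] (U : CfgY 𝔸 i) (p : PlaqY i) :
    (((holY i U p)⁻¹ : 𝔸ˣ) : 𝔸) = (U p.ν p.src : 𝔸) * (U p.μ (p.src.shift p.ν) : 𝔸) * (((U p.ν (p.src.shift p.μ))⁻¹ : 𝔸ˣ) : 𝔸) *
      (((U p.μ p.src)⁻¹ : 𝔸ˣ) : 𝔸) := by
  simp only [holY, mul_inv_rev, inv_inv, Units.val_mul, mul_assoc]

/-- `A′ ↦ U(∂p)` at `U = e^{iηA′}U₀` is holomorphic on every ball (a four-letter word in the pencil's letters).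
[cite: Balaban1985BackgroundPropagators, (3.1) p.390, Thm 3.4 p.400] -/
theorem differentiableOn_holY_prodCfg (p : PlaqY i) :
    DifferentiableOn ℂ (fun a => (holY i (prodCfg U₀ η a) p : 𝔸)) (ball (0 : Fin (d + 1) → Site (PV d ℓ i.m i.K hd hL) 0 → 𝔸) Rc) := by
  simp only [val_holY]
  exact (((differentiableOn_prodCfg_apply i U₀ η p.μ p.src).mul (differentiableOn_prodCfg_apply i U₀ η p.ν _)).mul
    (differentiableOn_prodCfg_inv_apply i U₀ η p.μ _)).mul (differentiableOn_prodCfg_inv_apply i U₀ η p.ν p.src)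

/-- `A′ ↦ U(∂p)⁻¹` at `U = e^{iηA′}U₀` is holomorphic on every ball. [cite: Balaban1985BackgroundPropagators, (3.1) p.390, (3.7) p.391, Thm 3.4 p.400] -/
theorem differentiableOn_holY_inv_prodCfg (p : PlaqY i) :
    DifferentiableOn ℂ (fun a => (((holY i (prodCfg U₀ η a) p)⁻¹ : 𝔸ˣ) : 𝔸))
      (ball (0 : Fin (d + 1) → Site (PV d ℓ i.m i.K hd hL) 0 → 𝔸) Rc) := by
  simp only [val_inv_holY]
  exact (((differentiableOn_prodCfg_apply i U₀ η p.ν p.src).mul (differentiableOn_prodCfg_apply i U₀ η p.μ _)).mul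
    (differentiableOn_prodCfg_inv_apply i U₀ η p.ν _)).mul (differentiableOn_prodCfg_inv_apply i U₀ η p.μ p.src)

omit [NormedAlgebra ℂ 𝔸] [CompleteSpace 𝔸] in
/-- A product of four factors of norm `≤ K` has norm `≤ K⁴` (plumbing). [folklore] -/
private theorem norm_mul₄_le {a b c e : 𝔸} {K : ℝ} (ha : ‖a‖ ≤ K) (hb : ‖b‖ ≤ K) (hc : ‖c‖ ≤ K) (he : ‖e‖ ≤ K) :
    ‖a * b * c * e‖ ≤ K ^ 4 := by
  have h0 : 0 ≤ K := (norm_nonneg _).trans ha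
  have h2 : ‖a * b‖ ≤ K * K := (norm_mul_le _ _).trans (mul_le_mul ha hb (norm_nonneg _) h0)
  have h3 : ‖a * b * c‖ ≤ K * K * K := (norm_mul_le _ _).trans (mul_le_mul h2 hc (norm_nonneg _) (mul_nonneg h0 h0))
  calc ‖a * b * c * e‖ ≤ ‖a * b * c‖ * ‖e‖ := norm_mul_le _ _
    _ ≤ K * K * K * K := mul_le_mul h3 he (norm_nonneg _) (mul_nonneg (mul_nonneg h0 h0) h0)
    _ = K ^ 4 := by ring

variable [NormOneClass 𝔸]

/-- On `‖A′‖ < R`: `‖U(∂p)‖ ≤ (K₀e^{|η|R})⁴` once `‖U₀(b)^{±1}‖ ≤ K₀`. [cite: Balaban1985BackgroundPropagators, (3.1) p.390, (3.35)–(3.37) p.396] -/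
theorem norm_holY_prodCfg_le (hU : ∀ μ x, ‖(U₀ μ x : 𝔸)‖ ≤ K₀) (hUi : ∀ μ x, ‖(((U₀ μ x)⁻¹ : 𝔸ˣ) : 𝔸)‖ ≤ K₀) (hRc : 0 ≤ Rc)
    {a : Fin (d + 1) → Site (PV d ℓ i.m i.K hd hL) 0 → 𝔸} (ha : a ∈ ball 0 Rc) (p : PlaqY i) :
    ‖(holY i (prodCfg U₀ η a) p : 𝔸)‖ ≤ (K₀ * Real.exp (|η| * Rc)) ^ 4 := by
  rw [val_holY]
  exact norm_mul₄_le (norm_prodCfg_apply_le i U₀ η hU hRc a ha _ _) (norm_prodCfg_apply_le i U₀ η hU hRc a ha _ _)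
    (norm_prodCfg_inv_apply_le i U₀ η hUi hRc a ha _ _) (norm_prodCfg_inv_apply_le i U₀ η hUi hRc a ha _ _)

/-- On `‖A′‖ < R`: `‖U(∂p)⁻¹‖ ≤ (K₀e^{|η|R})⁴`. [cite: Balaban1985BackgroundPropagators, (3.1) p.390, (3.7) p.391, (3.35)–(3.37) p.396] -/
theorem norm_holY_inv_prodCfg_le (hU : ∀ μ x, ‖(U₀ μ x : 𝔸)‖ ≤ K₀) (hUi : ∀ μ x, ‖(((U₀ μ x)⁻¹ : 𝔸ˣ) : 𝔸)‖ ≤ K₀) (hRc : 0 ≤ Rc)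
    {a : Fin (d + 1) → Site (PV d ℓ i.m i.K hd hL) 0 → 𝔸} (ha : a ∈ ball 0 Rc) (p : PlaqY i) :
    ‖(((holY i (prodCfg U₀ η a) p)⁻¹ : 𝔸ˣ) : 𝔸)‖ ≤ (K₀ * Real.exp (|η| * Rc)) ^ 4 := by
  rw [val_inv_holY]
  exact norm_mul₄_le (norm_prodCfg_apply_le i U₀ η hU hRc a ha _ _) (norm_prodCfg_apply_le i U₀ η hU hRc a ha _ _)
    (norm_prodCfg_inv_apply_le i U₀ η hUi hRc a ha _ _) (norm_prodCfg_inv_apply_le i U₀ η hUi hRc a ha _ _)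

omit [NormOneClass 𝔸] in
/-- `A′ ↦ Re U(∂p) = ½(U(∂p) + U(∂p)⁻¹)` at `U = e^{iηA′}U₀` is holomorphic on every ball (print's complexified reading of `Re`).
[cite: Balaban1985BackgroundPropagators, (3.7) p.391, Thm 3.4 p.400] -/
theorem differentiableOn_reHolY_prodCfg (p : PlaqY i) :
    DifferentiableOn ℂ (fun a => reHolY i (prodCfg U₀ η a) p) (ball (0 : Fin (d + 1) → Site (PV d ℓ i.m i.K hd hL) 0 → 𝔸) Rc) := by
  unfold reHolY
  exact ((differentiableOn_holY_prodCfg i U₀ η p).add (differentiableOn_holY_inv_prodCfg i U₀ η p)).const_smul (1 / 2 : ℂ)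

omit [NormOneClass 𝔸] in
/-- `A′ ↦ Im U(∂p) = (2i)⁻¹(U(∂p) − U(∂p)⁻¹)` at `U = e^{iηA′}U₀` is holomorphic on every ball.
[cite: Balaban1985BackgroundPropagators, (3.7) p.391, Thm 3.4 p.400] -/
theorem differentiableOn_imHolY_prodCfg (p : PlaqY i) :
    DifferentiableOn ℂ (fun a => imHolY i (prodCfg U₀ η a) p) (ball (0 : Fin (d + 1) → Site (PV d ℓ i.m i.K hd hL) 0 → 𝔸) Rc) := by
  unfold imHolY
  exact ((differentiableOn_holY_prodCfg i U₀ η p).sub (differentiableOn_holY_inv_prodCfg i U₀ η p)).const_smul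
    (-Complex.I / 2 : ℂ)

/-- On `‖A′‖ < R`: `‖Re U(∂p)‖ ≤ (K₀e^{|η|R})⁴`. [cite: Balaban1985BackgroundPropagators, (3.7) p.391, (3.35)–(3.37) p.396] -/
theorem norm_reHolY_prodCfg_le (hU : ∀ μ x, ‖(U₀ μ x : 𝔸)‖ ≤ K₀) (hUi : ∀ μ x, ‖(((U₀ μ x)⁻¹ : 𝔸ˣ) : 𝔸)‖ ≤ K₀) (hRc : 0 ≤ Rc)
    {a : Fin (d + 1) → Site (PV d ℓ i.m i.K hd hL) 0 → 𝔸} (ha : a ∈ ball 0 Rc) (p : PlaqY i) :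
    ‖reHolY i (prodCfg U₀ η a) p‖ ≤ (K₀ * Real.exp (|η| * Rc)) ^ 4 := by
  unfold reHolY
  refine (norm_smul_le _ _).trans ?_
  have h := (norm_add_le _ _).trans (add_le_add (norm_holY_prodCfg_le i U₀ η hU hUi hRc ha p)
    (norm_holY_inv_prodCfg_le i U₀ η hU hUi hRc ha p))
  have hc : ‖(1 / 2 : ℂ)‖ = 1 / 2 := by norm_num
  rw [hc]
  linarith

/-- On `‖A′‖ < R`: `‖Im U(∂p)‖ ≤ (K₀e^{|η|R})⁴`. [cite: Balaban1985BackgroundPropagators, (3.7) p.391, (3.35)–(3.37) p.396] -/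
theorem norm_imHolY_prodCfg_le (hU : ∀ μ x, ‖(U₀ μ x : 𝔸)‖ ≤ K₀) (hUi : ∀ μ x, ‖(((U₀ μ x)⁻¹ : 𝔸ˣ) : 𝔸)‖ ≤ K₀) (hRc : 0 ≤ Rc)
    {a : Fin (d + 1) → Site (PV d ℓ i.m i.K hd hL) 0 → 𝔸} (ha : a ∈ ball 0 Rc) (p : PlaqY i) :
    ‖imHolY i (prodCfg U₀ η a) p‖ ≤ (K₀ * Real.exp (|η| * Rc)) ^ 4 := by
  unfold imHolY
  refine (norm_smul_le _ _).trans ?_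
  have h := (norm_sub_le _ _).trans (add_le_add (norm_holY_prodCfg_le i U₀ η hU hUi hRc ha p)
    (norm_holY_inv_prodCfg_le i U₀ η hU hUi hRc ha p))
  have hc : ‖(-Complex.I / 2 : ℂ)‖ = 1 / 2 := by
    rw [norm_div, norm_neg, Complex.norm_I]; norm_num
  rw [hc]
  linarith

end Holonomy

/-! ## §3. The Jordan insertion along the pencil -/

section Jordan

variable {d ℓ : ℕ} {hd : 1 ≤ d + 1} {hL : Odd (ℓ + 1) ∧ 1 < ℓ + 1} {b₀ b₁ : ℝ}
variable (i : KIdx d ℓ hd hL b₀ b₁) (U₀ : CfgY 𝔸 i) (η : ℝ) {Rc K₀ S : ℝ}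

/-- **NODE 00's JORDAN INSERTION, UNFOLDED**: `(𝒦_U F)(p) = ½(F(p)·Re U(∂p) + Re U(∂p)·F(p))`.
[cite: Balaban1985BackgroundPropagators, (3.7) p.391, (3.10) p.392] -/
theorem jordanY_apply (U : CfgY 𝔸 i) (F : PlaqY i → 𝔸) (p : PlaqY i) :
    jordanY i U F p = (1 / 2 : ℂ) • (F p * reHolY i U p + reHolY i U p * F p) := rfl

/-- **THE JORDAN INSERTION OF AN `A′`-DEPENDENT HOLOMORPHIC FIELD IS HOLOMORPHIC** along the pencil: `A′ ↦ (𝒦_{e^{iηA′}U₀} Ψ(A′))(p)`.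
[cite: Balaban1985BackgroundPropagators, (3.7) p.391, (3.10) p.392, Thm 3.4 p.400] -/
theorem differentiableOn_jordanY_prodCfg {Ψ : (Fin (d + 1) → Site (PV d ℓ i.m i.K hd hL) 0 → 𝔸) → PlaqY i → 𝔸}
    (hΨ : ∀ p, DifferentiableOn ℂ (fun a => Ψ a p) (ball 0 Rc)) (p : PlaqY i) :
    DifferentiableOn ℂ (fun a => jordanY i (prodCfg U₀ η a) (Ψ a) p) (ball (0 : Fin (d + 1) → Site (PV d ℓ i.m i.K hd hL) 0 → 𝔸) Rc) := by
  simp only [jordanY_apply]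
  exact (((hΨ p).mul (differentiableOn_reHolY_prodCfg i U₀ η p)).add
    ((differentiableOn_reHolY_prodCfg i U₀ η p).mul (hΨ p))).const_smul (1 / 2 : ℂ)

variable [NormOneClass 𝔸]

/-- … **AND BOUNDED**: `‖Ψ(A′)(p)‖ ≤ S` on the ball ⟹ `‖(𝒦 Ψ(A′))(p)‖ ≤ (K₀e^{|η|R})⁴·S`.
[cite: Balaban1985BackgroundPropagators, (3.7) p.391, (3.10) p.392, Thm 3.4 p.400] -/
theorem norm_jordanY_prodCfg_le (hU : ∀ μ x, ‖(U₀ μ x : 𝔸)‖ ≤ K₀) (hUi : ∀ μ x, ‖(((U₀ μ x)⁻¹ : 𝔸ˣ) : 𝔸)‖ ≤ K₀) (hRc : 0 ≤ Rc)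
    {Ψ : (Fin (d + 1) → Site (PV d ℓ i.m i.K hd hL) 0 → 𝔸) → PlaqY i → 𝔸}
    (hS : ∀ a ∈ ball (0 : Fin (d + 1) → Site (PV d ℓ i.m i.K hd hL) 0 → 𝔸) Rc, ∀ p, ‖Ψ a p‖ ≤ S)
    {a : Fin (d + 1) → Site (PV d ℓ i.m i.K hd hL) 0 → 𝔸} (ha : a ∈ ball 0 Rc) (p : PlaqY i) :
    ‖jordanY i (prodCfg U₀ η a) (Ψ a) p‖ ≤ (K₀ * Real.exp (|η| * Rc)) ^ 4 * S := by
  rw [jordanY_apply]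
  refine (norm_smul_le _ _).trans ?_
  have hr := norm_reHolY_prodCfg_le i U₀ η hU hUi hRc ha p
  have hs := hS a ha p
  have h0 : 0 ≤ S := (norm_nonneg _).trans hs
  have h1 : 0 ≤ (K₀ * Real.exp (|η| * Rc)) ^ 4 := (norm_nonneg _).trans hr
  have h := (norm_add_le _ _).trans (add_le_add
    ((norm_mul_le _ _).trans (mul_le_mul hs hr (norm_nonneg _) h0))
    ((norm_mul_le _ _).trans (mul_le_mul hr hs (norm_nonneg _) h1)))
  have hc : ‖(1 / 2 : ℂ)‖ = 1 / 2 := by norm_num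
  rw [hc]
  nlinarith

end Jordan

/-! ## §4. ★ The first Hessian term `D*_U ∘ 𝒦_U ∘ D^η_U` along the pencil -/

section DKD

variable {d ℓ : ℕ} {hd : 1 ≤ d + 1} {hL : Odd (ℓ + 1) ∧ 1 < ℓ + 1} {b₀ b₁ : ℝ}
variable (i : KIdx d ℓ hd hL b₀ b₁) (U₀ : CfgY 𝔸 i) (η : ℝ) {Rc K₀ S c₁ c₂ : ℝ}

/-- ★ **THE COVARIANT CURL OF A FIXED FIELD ALONG THE PENCIL IS HOLOMORPHIC**: `A′ ↦ (D^η_{e^{iηA′}U₀} Λ)(p)` for every `Λ`, `p`.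
[cite: Balaban1985BackgroundPropagators, (3.4) p.391, Thm 3.4 p.400] -/
theorem differentiableOn_curlY_prodCfg_apply (Λ : FBondY i → 𝔸) (p : PlaqY i) :
    DifferentiableOn ℂ (fun a => curlY i (prodCfg U₀ η a) Λ p) (ball (0 : Fin (d + 1) → Site (PV d ℓ i.m i.K hd hL) 0 → 𝔸) Rc) :=
  differentiableOn_trLiftY_apply (curlK i) (fun a => curlT i (prodCfg U₀ η a)) (Rc := Rc) (differentiableOn_curlT_prodCfg i U₀ η)
    (differentiableOn_curlT_inv_prodCfg i U₀ η) (Ψ := fun _ => Λ) (fun x => differentiableOn_const (Λ x)) p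

variable [NormOneClass 𝔸]

/-- … with the bound `‖(D^η Λ)(p)‖ ≤ c₁·(Kη·‖Λ‖·Kη)` on `‖A′‖ < R`, `Kη = K₀e^{|η|R}`, `c₁ ≥ Σ_b |curlK(p,b)|`.
[cite: Balaban1985BackgroundPropagators, (3.4) p.391, Thm 3.4 p.400] -/
theorem norm_curlY_prodCfg_apply_le (hU : ∀ μ x, ‖(U₀ μ x : 𝔸)‖ ≤ K₀) (hUi : ∀ μ x, ‖(((U₀ μ x)⁻¹ : 𝔸ˣ) : 𝔸)‖ ≤ K₀) (hK1 : 1 ≤ K₀)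
    (hRc : 0 ≤ Rc) (hc₁ : ∀ p, ∑ b, |curlK i p b| ≤ c₁) (Λ : FBondY i → 𝔸)
    {a : Fin (d + 1) → Site (PV d ℓ i.m i.K hd hL) 0 → 𝔸} (ha : a ∈ ball 0 Rc) (p : PlaqY i) :
    ‖curlY i (prodCfg U₀ η a) Λ p‖ ≤ c₁ * (K₀ * Real.exp (|η| * Rc) * ‖Λ‖ * (K₀ * Real.exp (|η| * Rc))) := by
  refine (norm_trLiftY_apply_le (curlK i) (fun a => curlT i (prodCfg U₀ η a)) (norm_curlT_prodCfg_le i U₀ η hU hK1 hRc)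
    (norm_curlT_inv_prodCfg_le i U₀ η hUi hK1 hRc) (Ψ := fun _ => Λ) (fun _ _ b => norm_le_pi_norm Λ b) ha p).trans ?_
  have h0 : 0 ≤ K₀ * Real.exp (|η| * Rc) := mul_nonneg (zero_le_one.trans hK1) (Real.exp_nonneg _)
  exact mul_le_mul_of_nonneg_right (hc₁ p) (mul_nonneg (mul_nonneg h0 (norm_nonneg _)) h0)

omit [NormOneClass 𝔸] in
/-- ★★ **THE FIRST HESSIAN TERM ALONG THE PENCIL IS HOLOMORPHIC**: for every input field `Λ` and every bond `b`,
`A′ ↦ ((D*_U ∘ 𝒦_U ∘ D^η_U) Λ)(b)` at `U = e^{iηA′}U₀` is holomorphic on every chart ball — the `Re U(∂p)`-part of `⟨A, Δ(U′U₀)A⟩` as an «analytic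
function of A′» at NODE 00's operator (`coCurlY ∘ₗ jordanY ∘ₗ curlY`, the first summand of `hessY`).
[cite: Balaban1985BackgroundPropagators, (3.10) p.392, Thm 3.4 and (3.50) p.400] -/
theorem differentiableOn_dKd_prodCfg (Λ : FBondY i → 𝔸) (b : FBondY i) :
    DifferentiableOn ℂ (fun a => (coCurlY i (prodCfg U₀ η a) ∘ₗ jordanY i (prodCfg U₀ η a) ∘ₗ curlY i (prodCfg U₀ η a)) Λ b)
      (ball (0 : Fin (d + 1) → Site (PV d ℓ i.m i.K hd hL) 0 → 𝔸) Rc) := by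
  simp only [LinearMap.comp_apply]
  refine differentiableOn_trLiftY_apply (cocurlK i) (fun a b p => (curlT i (prodCfg U₀ η a) p b)⁻¹) (Rc := Rc)
    (fun b p => differentiableOn_curlT_inv_prodCfg i U₀ η p b) (fun b p => ?_)
    (Ψ := fun a => jordanY i (prodCfg U₀ η a) (curlY i (prodCfg U₀ η a) Λ)) (fun p => ?_) b
  · simpa only [inv_inv] using differentiableOn_curlT_prodCfg i U₀ η (Rc := Rc) p b
  · exact differentiableOn_jordanY_prodCfg i U₀ η (fun p => differentiableOn_curlY_prodCfg_apply i U₀ η Λ p) p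

/-- ★★ **… WITH THE BOUND** `‖((D* 𝒦 D^η) Λ)(b)‖ ≤ c₂·(Kη·(Kη⁴·(c₁·(Kη·‖Λ‖·Kη)))·Kη)` on `‖A′‖ < R` (`Kη = K₀e^{|η|R}`; `c₁`, `c₂` row-sum bounds of
`curlK`, `cocurlK`). [cite: Balaban1985BackgroundPropagators, (3.10) p.392, Thm 3.4 p.400, (3.108) p.416] -/
theorem norm_dKd_prodCfg_le (hU : ∀ μ x, ‖(U₀ μ x : 𝔸)‖ ≤ K₀) (hUi : ∀ μ x, ‖(((U₀ μ x)⁻¹ : 𝔸ˣ) : 𝔸)‖ ≤ K₀) (hK1 : 1 ≤ K₀)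
    (hRc : 0 ≤ Rc) (hc₀ : 0 ≤ c₁) (hc₁ : ∀ p, ∑ b, |curlK i p b| ≤ c₁) (hc₂ : ∀ b, ∑ p, |cocurlK i b p| ≤ c₂)
    (Λ : FBondY i → 𝔸) {a : Fin (d + 1) → Site (PV d ℓ i.m i.K hd hL) 0 → 𝔸} (ha : a ∈ ball 0 Rc) (b : FBondY i) :
    ‖(coCurlY i (prodCfg U₀ η a) ∘ₗ jordanY i (prodCfg U₀ η a) ∘ₗ curlY i (prodCfg U₀ η a)) Λ b‖ ≤
      c₂ * (K₀ * Real.exp (|η| * Rc) *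
        ((K₀ * Real.exp (|η| * Rc)) ^ 4 * (c₁ * (K₀ * Real.exp (|η| * Rc) * ‖Λ‖ * (K₀ * Real.exp (|η| * Rc))))) *
        (K₀ * Real.exp (|η| * Rc))) := by
  have h0 : 0 ≤ K₀ * Real.exp (|η| * Rc) := mul_nonneg (zero_le_one.trans hK1) (Real.exp_nonneg _)
  have hTf : ∀ a ∈ ball (0 : Fin (d + 1) → Site (PV d ℓ i.m i.K hd hL) 0 → 𝔸) Rc, ∀ (b : FBondY i) (p : PlaqY i),
      ‖(((curlT i (prodCfg U₀ η a) p b)⁻¹ : 𝔸ˣ) : 𝔸)‖ ≤ K₀ * Real.exp (|η| * Rc) :=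
    fun a ha b p => norm_curlT_inv_prodCfg_le i U₀ η hUi hK1 hRc a ha p b
  have hTb : ∀ a ∈ ball (0 : Fin (d + 1) → Site (PV d ℓ i.m i.K hd hL) 0 → 𝔸) Rc, ∀ (b : FBondY i) (p : PlaqY i),
      ‖((((curlT i (prodCfg U₀ η a) p b)⁻¹)⁻¹ : 𝔸ˣ) : 𝔸)‖ ≤ K₀ * Real.exp (|η| * Rc) := by
    intro a ha b p
    rw [inv_inv]
    exact norm_curlT_prodCfg_le i U₀ η hU hK1 hRc a ha p b
  have hΨ : ∀ a ∈ ball (0 : Fin (d + 1) → Site (PV d ℓ i.m i.K hd hL) 0 → 𝔸) Rc, ∀ p,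
      ‖jordanY i (prodCfg U₀ η a) (curlY i (prodCfg U₀ η a) Λ) p‖ ≤
        (K₀ * Real.exp (|η| * Rc)) ^ 4 * (c₁ * (K₀ * Real.exp (|η| * Rc) * ‖Λ‖ * (K₀ * Real.exp (|η| * Rc)))) :=
    fun a ha p => norm_jordanY_prodCfg_le i U₀ η hU hUi hRc (Ψ := fun a => curlY i (prodCfg U₀ η a) Λ)
      (fun a ha p => norm_curlY_prodCfg_apply_le i U₀ η hU hUi hK1 hRc hc₁ Λ ha p) ha p
  have h := norm_trLiftY_apply_le (cocurlK i) (fun a b p => (curlT i (prodCfg U₀ η a) p b)⁻¹) hTf hTb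
    (Ψ := fun a => jordanY i (prodCfg U₀ η a) (curlY i (prodCfg U₀ η a) Λ)) hΨ ha b
  refine h.trans (mul_le_mul_of_nonneg_right (hc₂ b) (mul_nonneg (mul_nonneg h0 (mul_nonneg (pow_nonneg h0 4) ?_)) h0))
  exact mul_nonneg hc₀ (mul_nonneg (mul_nonneg h0 (norm_nonneg _)) h0)

omit [NormOneClass 𝔸] in
/-- **IT IS `Δ(U) − Δ′₂(U)`**: the composite is NODE 00's `hessY U − curv2Y U` (definition `hessY U = coCurlY U ∘ₗ jordanY U ∘ₗ curlY U + curv2Y U`).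
[cite: Balaban1985BackgroundPropagators, (3.10) p.392] -/
theorem dKd_eq_hessY_sub_curv2Y (U : CfgY 𝔸 i) :
    coCurlY i U ∘ₗ jordanY i U ∘ₗ curlY i U = hessY i U - curv2Y i U := by
  rw [hessY, add_sub_cancel_right]

end DKD

end Literature.MathematicalPhysics.QuantumFieldTheory.Balaban1983to89.B13OpsYPencilHolonomy

end
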